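import Mathlib
import Literature.MathematicalPhysics.QuantumLattice.TorusPairSusceptibility
import Literature.MathematicalPhysics.QuantumLattice.HubbardModel
import Summits.HubbardSuperconductivity.HubbardSuperconductivity.Theorems.EnslavedA1gLowerSandwich
import Summits.HubbardSuperconductivity.HubbardSuperconductivity.Theorems.EnslavedA1gUpperSandwichRemovalWindow
import Summits.HubbardSuperconductivity.HubbardSuperconductivity.Theorems.WeakCouplingBCSWcbcsSsbToTorusLROChargingRate
import HarnessLib

/-!
# Crux `WcbcsSsbToTorusLRO` (stmt-HubbardSuperconductivity-2009), line `off-zero-mode-moment-closure`: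
# the FLOATING-FILLING charging floor (the C-body holds for free polylog-close to `N_L`)

Companion to the registered stub (C) `stub_chargingFloor` (which pins the filling `N_L = 2⌊(1−δ)L²/2⌋`) and to its
adapter `chargingFloor_of_rate` (Theorems/WeakCouplingBCSWcbcsSsbToTorusLROChargingRate.lean). The two tree
first-difference bounds on the even torus, `E(2m+2) ≤ E(2m) + U` (Yang's `η`-pair ceiling,
`EnslavedA1g.minEnergyOn_szSector_add_two_le`) and `E(2n) ≤ E(2n+2) + 8` (removal window,
`EnslavedA1g.UpperSandwich.minEnergyOn_szSector_le_add_two`), telescope: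
`Σ_{j<J} pairGap H (2(n₀+1+j)) = ½[(E(2(n₀+1+J)) − E(2(n₀+J))) − (E(2(n₀+1)) − E(2n₀))] ≥ −(8+U)/2`, so every window of
`J` consecutive admissible even fillings contains one with `pairGap ≥ −(8+U)/(2J)` (`exists_pairGap_ge_of_window`).
With `J = ⌊(1 + log L)²⌋ + 1` this gives `exists_near_filling_chargingFloor`: for every `U ≥ 0`, `δ ∈ (0,1/2)`, `ε > 0`,
eventually along even sides there is an even filling `N'` with `N_L ≤ N' ≤ N_L + 2(1 + log L)²` and
`−ε ≤ (1 + log L)·pairGap (hubbardTorus 2 L 1 U) N'` — the C-body VERBATIM, unguarded, at a filling polylog-close to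
`N_L`. It is NOT the stub: a single pinned filling is invisible to telescoping (first-difference) information, which is
exactly what makes (C) open at fixed `U > 0`. Elementary bookkeeping over the tree's definitions; no definition and no
named fact is introduced.
-/

noncomputable section

set_option linter.dupNamespace false

namespace Summit.HubbardSuperconductivity.HubbardSuperconductivity.Theorems.WcbcsSsbToTorusLRO

open Literature.MathematicalPhysics.QuantumLattice Literature.Probability.LatticeModels
open Filter Set Finset

/-- Telescoping of the pair gap over a window of even fillings:
`Σ_{j<J} pairGap H (2(n₀+1+j)) = ½ [(E(2(n₀+1+J)) − E(2(n₀+J))) − (E(2(n₀+1)) − E(2n₀))]`. [folklore] -/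
theorem sum_pairGap_window {Λ : Type*} [LinearOrder Λ] [Fintype Λ]
    (H : Matrix (Finset (Orb Λ)) (Finset (Orb Λ)) ℂ) (n₀ J : ℕ) :
    ∑ j ∈ Finset.range J, pairGap H (2 * (n₀ + 1 + j)) =
      ((H.minEnergyOn (szSector (2 * (n₀ + 1 + J)) 0) - H.minEnergyOn (szSector (2 * (n₀ + J)) 0)) -
        (H.minEnergyOn (szSector (2 * (n₀ + 1)) 0) - H.minEnergyOn (szSector (2 * n₀) 0))) / 2 := by
  -- `g j = E(2(n₀+1+j)) − E(2(n₀+j))`, `pairGap (2(n₀+1+j)) = (g (j+1) − g j)/2`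
  set g : ℕ → ℝ := fun j =>
    H.minEnergyOn (szSector (2 * (n₀ + 1 + j)) 0) - H.minEnergyOn (szSector (2 * (n₀ + j)) 0) with hg
  have hterm : ∀ j, pairGap H (2 * (n₀ + 1 + j)) = (g (j + 1) - g j) / 2 := by
    intro j
    simp only [hg, pairGap]
    have e1 : 2 * (n₀ + 1 + j) + 2 = 2 * (n₀ + 1 + (j + 1)) := by ring
    have e2 : 2 * (n₀ + 1 + j) - 2 = 2 * (n₀ + j) := by omega
    have e3 : 2 * (n₀ + (j + 1)) = 2 * (n₀ + 1 + j) := by ring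
    rw [e1, e2, e3]
    ring
  simp_rw [hterm]
  rw [← Finset.sum_div, Finset.sum_range_sub]
  simp only [hg, add_zero]

/-- **Floating-filling charging floor.** On the torus `(ℤ/Lℤ)²` of even side, `U ≥ 0`, for every window of `J ≥ 1`
consecutive even fillings `2(n₀+1), …, 2(n₀+J)` with `2(n₀+J) + 2 ≤ L²` there is a filling in the window whose pair gap
is `≥ −(8+U)/(2J)`: the window sum of pair gaps telescopes to half the difference of two first differences, bounded by
the η-ceiling `E(M+2) − E(M) ≤ U` and the removal window `E(M+2) − E(M) ≥ −8`. [folklore] -/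
theorem exists_pairGap_ge_of_window (L : ℕ) [NeZero L] (hL : Even L) {U : ℝ} (hU : 0 ≤ U)
    (n₀ J : ℕ) (hJ : 1 ≤ J) (htop : 2 * (n₀ + J) + 2 ≤ L ^ 2) :
    ∃ j < J, -(8 + U) / (2 * J) ≤ pairGap (hubbardTorus 2 L 1 U) (2 * (n₀ + 1 + j)) := by
  by_contra hcon
  push Not at hcon
  set H := hubbardTorus 2 L 1 U with hH
  -- the window sum is `< -(8+U)/2`
  have hlt : ∑ j ∈ Finset.range J, pairGap H (2 * (n₀ + 1 + j)) <
      ∑ j ∈ Finset.range J, (-(8 + U) / (2 * J) : ℝ) :=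
    Finset.sum_lt_sum_of_nonempty (Finset.nonempty_range_iff.2 (by omega))
      fun j hj => hcon j (Finset.mem_range.1 hj)
  rw [Finset.sum_const, Finset.card_range, nsmul_eq_mul] at hlt
  have hJr : (0 : ℝ) < J := by exact_mod_cast hJ
  have hrhs : (J : ℝ) * (-(8 + U) / (2 * J)) = -(8 + U) / 2 := by
    field_simp
  rw [hrhs, sum_pairGap_window] at hlt
  -- the two first-difference bounds
  have hη : H.minEnergyOn (szSector (2 * (n₀ + 1)) 0) ≤ H.minEnergyOn (szSector (2 * n₀) 0) + U :=
    Summit.HubbardSuperconductivity.EnslavedA1g.minEnergyOn_szSector_add_two_le hL U (m := n₀) (by omega)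
  have hrem : H.minEnergyOn (szSector (2 * (n₀ + J)) 0) ≤
      H.minEnergyOn (szSector (2 * (n₀ + J) + 2) 0) + 8 * |(1 : ℝ)| :=
    Summit.HubbardSuperconductivity.HubbardSuperconductivity.Theorems.EnslavedA1g.UpperSandwich.minEnergyOn_szSector_le_add_two
      L 1 hU (n := n₀ + J) (by omega)
  have e : 2 * (n₀ + J) + 2 = 2 * (n₀ + 1 + J) := by ring
  rw [e, abs_one, mul_one] at hrem
  linarith

/-- `(1 + log x)² ≤ 2 + 8x` for `x ≥ 1` (`log x ≤ 2√x`). [folklore] -/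
theorem one_add_log_sq_le {x : ℝ} (hx : 1 ≤ x) : (1 + Real.log x) ^ 2 ≤ 2 + 8 * x := by
  have hx0 : 0 ≤ x := by linarith
  set y : ℝ := x ^ (1 / 2 : ℝ) with hy
  have hy0 : 0 ≤ y := Real.rpow_nonneg hx0 _
  have hy2 : y ^ 2 = x := by
    rw [hy, ← Real.rpow_natCast, ← Real.rpow_mul hx0]
    norm_num
  have hlog : Real.log x ≤ 2 * y := by
    have h := Real.log_le_rpow_div hx0 (by norm_num : (0:ℝ) < 1 / 2)
    rw [← hy] at h
    linarith [h, show y / (1 / 2 : ℝ) = 2 * y by ring]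
  have hlog0 : 0 ≤ Real.log x := Real.log_nonneg hx
  have h1 : (1 + Real.log x) ^ 2 ≤ (1 + 2 * y) ^ 2 := by
    apply pow_le_pow_left₀ (by linarith) (by linarith)
  nlinarith [sq_nonneg (2 * y - 1), h1, hy2]

/-- **The C-body at a floating filling polylog-close to `N_L` (for every `U ≥ 0`, `δ ∈ (0, 1/2)`; no guard).**
For every `ε > 0`, eventually along even sides `L = 2k+2` there is an even filling `N'` with
`N_L ≤ N' ≤ N_L + 2(1 + log L)²` and `−ε ≤ (1 + log L) · pairGap (hubbardTorus 2 L 1 U) N'`: the window lemma with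
`J = ⌊(1 + log L)²⌋ + 1`. It is NOT the stub (C), which fixes the filling `N_L`. [folklore] -/
theorem exists_near_filling_chargingFloor :
    ∀ (U : ℝ), 0 ≤ U → ∀ (δ : ℝ), δ ∈ Set.Ioo (0:ℝ) (1 / 2) → ∀ ε : ℝ, 0 < ε → ∀ᶠ k : ℕ in Filter.atTop, ∃ N' : ℕ, Even N' ∧ 2 * ⌊(1 - δ) * ((2 * k + 1 + 1 : ℕ) : ℝ) ^ 2 / 2⌋₊ ≤ N' ∧ (N' : ℝ) ≤ 2 * ⌊(1 - δ) * ((2 * k + 1 + 1 : ℕ) : ℝ) ^ 2 / 2⌋₊ + 2 * (1 + Real.log ((2 * k + 1 + 1 : ℕ) : ℝ)) ^ 2 ∧ -ε ≤ (1 + Real.log ((2 * k + 1 + 1 : ℕ) : ℝ)) * pairGap (hubbardTorus 2 (2 * k + 1 + 1) 1 U) N' := by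
  intro U hU δ hδ
  obtain ⟨hδ0, hδ1⟩ := hδ
  intro ε hε
  have hev1 : ∀ᶠ k : ℕ in atTop, 22 / δ ≤ ((2 * k + 1 + 1 : ℕ) : ℝ) :=
    tendsto_evenSide_atTop.eventually_ge_atTop _
  have hev2 : ∀ᶠ k : ℕ in atTop, (8 + U) / (2 * ε) ≤ Real.log ((2 * k + 1 + 1 : ℕ) : ℝ) :=
    (Real.tendsto_log_atTop.comp tendsto_evenSide_atTop).eventually_ge_atTop _
  filter_upwards [hev1, hev2] with k hk1 hk2
  -- notation
  set L : ℕ := 2 * k + 1 + 1 with hLdef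
  set x : ℝ := ((2 * k + 1 + 1 : ℕ) : ℝ) with hxdef
  have hxL : (L : ℝ) = x := by rw [hLdef, hxdef]
  have hLeven : Even L := ⟨k + 1, by rw [hLdef]; ring⟩
  have hx2 : (2 : ℝ) ≤ x := by
    rw [hxdef]; exact_mod_cast (by omega : 2 ≤ 2 * k + 1 + 1)
  have hx1 : (1 : ℝ) ≤ x := by linarith
  have hδx : 22 / δ ≤ x := hk1
  have h22 : 22 ≤ δ * x := by
    have := (div_le_iff₀ hδ0).1 hδx
    linarith [this]
  have hx44 : (44 : ℝ) ≤ x := by nlinarith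
  have hlog0 : 0 ≤ Real.log x := Real.log_nonneg hx1
  have hl1 : 0 < 1 + Real.log x := by linarith
  -- the summit number `n`, `N_L = 2n`, and the window length `J`
  set n : ℕ := ⌊(1 - δ) * x ^ 2 / 2⌋₊ with hndef
  have hxsq : (0 : ℝ) ≤ (1 - δ) * x ^ 2 / 2 := by
    have : 0 ≤ x ^ 2 := sq_nonneg x
    have : 0 ≤ (1 - δ) := by linarith
    positivity
  have hnle : (n : ℝ) ≤ (1 - δ) * x ^ 2 / 2 := Nat.floor_le hxsq
  have hn1 : 1 ≤ n := by
    rw [hndef]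
    apply Nat.le_floor
    push_cast
    nlinarith
  set J : ℕ := ⌊(1 + Real.log x) ^ 2⌋₊ + 1 with hJdef
  have hJ1 : 1 ≤ J := by omega
  have hJle : ((J : ℕ) : ℝ) ≤ (1 + Real.log x) ^ 2 + 1 := by
    rw [hJdef]; push_cast
    linarith [Nat.floor_le (sq_nonneg (1 + Real.log x))]
  have hJgt : (1 + Real.log x) ^ 2 < (J : ℝ) := by
    rw [hJdef]; push_cast
    exact Nat.lt_floor_add_one _
  have hJpos : (0 : ℝ) < J := by exact_mod_cast hJ1
  -- the window fits below `L²`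
  have hlogsq : (1 + Real.log x) ^ 2 ≤ 2 + 8 * x := one_add_log_sq_le hx1
  have htopR : (2 * ((n - 1 : ℕ) + J) + 2 : ℝ) ≤ (L : ℝ) ^ 2 := by
    have hsub : ((n - 1 : ℕ) : ℝ) = n - 1 := by
      rw [Nat.cast_sub hn1]; simp
    rw [hsub, hxL]
    nlinarith [hnle, hJle, hlogsq, h22]
  have htop : 2 * ((n - 1) + J) + 2 ≤ L ^ 2 := by exact_mod_cast htopR
  -- the window lemma
  obtain ⟨j, hjJ, hj⟩ := exists_pairGap_ge_of_window L hLeven hU (n - 1) J hJ1 htop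
  have hfill : 2 * (n - 1 + 1 + j) = 2 * (n + j) := by congr 1; omega
  rw [hfill] at hj
  refine ⟨2 * (n + j), even_two_mul _, ?_, ?_, ?_⟩
  · -- `N_L ≤ N'`
    change 2 * n ≤ 2 * (n + j)
    omega
  · -- `N' ≤ N_L + 2(1 + log L)²`
    change ((2 * (n + j) : ℕ) : ℝ) ≤ 2 * (n : ℝ) + 2 * (1 + Real.log x) ^ 2
    have hjle : (j : ℝ) ≤ (1 + Real.log x) ^ 2 := by
      have : j ≤ ⌊(1 + Real.log x) ^ 2⌋₊ := by omega
      exact (Nat.cast_le.2 this).trans (Nat.floor_le (sq_nonneg _))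
    push_cast
    linarith
  · -- `−ε ≤ (1 + log L)·pairGap`
    change -ε ≤ (1 + Real.log x) * pairGap (hubbardTorus 2 L 1 U) (2 * (n + j))
    have hstep : -(8 + U) / (2 * (1 + Real.log x) ^ 2) ≤ -(8 + U) / (2 * (J : ℝ)) := by
      rw [neg_div, neg_div, neg_le_neg_iff]
      apply div_le_div_of_nonneg_left (by linarith) (by positivity) (by linarith)
    have hpg : -(8 + U) / (2 * (1 + Real.log x) ^ 2) ≤ pairGap (hubbardTorus 2 L 1 U) (2 * (n + j)) :=
      hstep.trans hj
    have hmul := mul_le_mul_of_nonneg_left hpg hl1.le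
    have e1 : (1 + Real.log x) * (-(8 + U) / (2 * (1 + Real.log x) ^ 2)) = -((8 + U) / (2 * (1 + Real.log x))) := by
      field_simp
    rw [e1] at hmul
    have hε' : (8 + U) / (2 * (1 + Real.log x)) ≤ ε := by
      rw [div_le_iff₀ (by positivity)]
      have := (div_le_iff₀ (by positivity : (0:ℝ) < 2 * ε)).1 hk2
      nlinarith
    linarith

end Summit.HubbardSuperconductivity.HubbardSuperconductivity.Theorems.WcbcsSsbToTorusLRO

end
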